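import Summits.CriticalPhenomena.SAWScalingLimit.Theorems.SAWDevelopingMapObservableToSLETypeLadderBandDefs
import HarnessLib

/-!
# Splicing band families (band iteration, piece I6) for the abundance residue of `ObservableToSLE`

Crux `Summit.CriticalPhenomena.SAWScalingLimit.Theses.SAWDevelopingMap.ObservableToSLE`
(item stmt-CriticalPhenomena-10472), line `six-class-type-ladder`, skeleton r16 (band-wise cut of the abundance
residue): the registered stub `stub_spliceBandFamilies`.

Given `m ≥ 1` band families `B 0, …, B (m-1)` (`BandFamily`, vocabulary of
`…TypeLadderBandDefs.lean`) at separated scales — band `k` contains the closed `ρin k`-ball, lies in the closed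
`ρout k`-ball, and `ρout k ≤ ρin (k+1)` — we list their levels in ONE sequence `S`: band `0` up to its
stabilisation index, then band `1`, …, then the last band with its own indexing forever.  The result is a tame
nested family (`TameNestedFamily`) of radius `R ≥ ρout k`, every level of which IS a band level (so the per-level
designer clauses transfer verbatim), and every band level occurs.

* `spliceSched_fst_lt`, `spliceSched_add`, `spliceSched_off`, `spliceSched_last` — bookkeeping of the splice
  schedule `sched n` = the pair (band, level) listed at position `n` and of the offsets `off k` at which band `k`
  enters, both characterised by their recursions (and built by `Nat.rec` inside the proof: no new definition);
* `classWindows_nonneg`, `root_mem_of_bandFamily` — the root lies in every level of a band family (no sign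
  hypothesis is needed: the class-`j` window clause excludes `ρ < 0`, and for `0 ≤ ρ` the root is on the fat spine);
* `stub_spliceBandFamilies` — the registered stub.
-/

noncomputable section

open scoped BigOperators Topology NNReal ENNReal Classical
open Filter Set MeasureTheory Metric
open Literature.Probability.LatticeModels (HexVertex hexGraph hexCenter triZeta Site)
open Literature.Probability.RandomPlanarGeometry
open Literature.Probability.RandomPlanarGeometry.SAW

namespace Summit.CriticalPhenomena.SAWScalingLimit.Theorems.ObservableToSLE.TypeLadder

open Summit.CriticalPhenomena.SAWScalingLimit.Theorems.ObservableToSLER.BridgeGate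
  (hexBall HasCleanWindow carvedLaw rowOf)
open Summit.CriticalPhenomena.SAWScalingLimit.Theorems.ObservableToSLER.NestedGate

/-! ### The root lies in every level of a band family -/

/-- Every class `k : Fin 6` is the gate class of some pair of vertices: their signed rows of class `k` differ by
one. [folklore] -/
theorem exists_rowOf_eq_add_one (k : Fin 6) : ∃ a b : HexVertex, rowOf k b = rowOf k a + 1 := by
  fin_cases k
  · exact ⟨(0, 0), (![0, 1], 0), by simp [rowOf, ObservableToSLER.BridgeGate.rowCoord]⟩
  · exact ⟨(0, 0), (![-1, 0], 0), by simp [rowOf, ObservableToSLER.BridgeGate.rowCoord]⟩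
  · exact ⟨(0, 0), (![-1, 0], 0), by simp [rowOf, ObservableToSLER.BridgeGate.rowCoord]⟩
  · exact ⟨(0, 0), (![0, -1], 0), by simp [rowOf, ObservableToSLER.BridgeGate.rowCoord]⟩
  · exact ⟨(0, 0), (![1, 0], 0), by simp [rowOf, ObservableToSLER.BridgeGate.rowCoord]⟩
  · exact ⟨(0, 0), (![1, 0], 0), by simp [rowOf, ObservableToSLER.BridgeGate.rowCoord]⟩

/-- **The class-`j` window clause forces `0 ≤ ρ`.**  For `ρ < 0` the window balls are empty, so EVERY pair of
vertices with some gate class carries a (degenerate) clean `ρ`-window of any level; at a pair of antipodal class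
`j + 3` the clause `rowOf j q = rowOf j p + 1` then contradicts `rowOf (j + 3) = -rowOf j`. [folklore] -/
theorem classWindows_nonneg {j : Fin 6} {Ω : Set ℂ} {δ ρ : ℝ} {S : ℕ → Set HexVertex}
    (h : ClassWindows j Ω δ ρ S) : 0 ≤ ρ := by
  rcases le_or_gt 0 ρ with hρ | hρ
  · exact hρ
  · exfalso
    obtain ⟨a, b, hab⟩ := exists_rowOf_eq_add_one (j + 3)
    have hw : HasCleanWindow Ω δ ρ (S 0) a b := by
      refine ⟨?_, j + 3, hab, fun x hx => ?_⟩
      · rw [Metric.closedBall_eq_empty.2 hρ]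
        exact Set.empty_subset _
      · rw [Metric.ball_eq_empty.2 hρ.le] at hx
        exact absurd hx (Set.notMem_empty _)
    have h1 := (h 0 a b hw).1
    rw [ObservableToSLER.BridgeGate.rowOf_add_three, ObservableToSLER.BridgeGate.rowOf_add_three] at hab
    omega

/-- **The root lies in every level of a band family**: `0 ≤ ρ` by `classWindows_nonneg`, and the rescaled root lies
ON the fat spine of the level, at `infDist = 0 ≤ ρ / 8` from it. [folklore] -/
theorem root_mem_of_bandFamily {Ω : Set ℂ} {δ ρin ρout ρ Rfar : ℝ} {z₀ w : ℂ} {N : ℕ} {j : Fin 6}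
    {c : HexVertex} {S : ℕ → Set HexVertex} (h : BandFamily Ω δ ρin ρout ρ Rfar z₀ w N j c S) (i : ℕ) :
    c ∈ S i := by
  have hρ : 0 ≤ ρ := classWindows_nonneg h.2.2.2.2.2.2.2.1
  obtain ⟨K, -, -, hcK, hK, -⟩ := h.2.2.2.2.2.2.2.2.2.1 i
  exact hK c (by rw [Metric.infDist_zero_of_mem hcK]; linarith)

/-! ### The splice schedule -/

/-- **Every scheduled band index is `< m`.**  Here and below `sched : ℕ → ℕ × ℕ` is the SPLICE SCHEDULE of `m ≥ 1`
bands with stabilisation indices `n₀` — the pair (band, level) listed at position `n` — characterised by its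
recursion: it starts at `(0, 0)`; after `(k, i)` comes `(k + 1, 0)` if band `k` has stabilised (`n₀ k ≤ i`) and a
next band exists (`k + 1 < m`), and `(k, i + 1)` otherwise (so the last band keeps its own indexing forever).  It is
constructed by `Nat.rec` inside the proof of the stub; no definition is added to the tree. -/
theorem spliceSched_fst_lt {m : ℕ} {n₀ : ℕ → ℕ} {sched : ℕ → ℕ × ℕ} (h0 : sched 0 = (0, 0))
    (hs : ∀ n, sched (n + 1) =
      if (sched n).1 + 1 < m ∧ n₀ (sched n).1 ≤ (sched n).2 then ((sched n).1 + 1, 0)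
      else ((sched n).1, (sched n).2 + 1))
    (hm : 0 < m) (n : ℕ) : (sched n).1 < m := by
  induction n with
  | zero => rw [h0]; exact hm
  | succ n ih =>
    rw [hs]
    split_ifs with h
    · exact h.1
    · exact ih

/-- **Inside a band**: if the schedule is at `(k, 0)` at position `p`, then it is at `(k, i)` at position `p + i`
for every `i ≤ n₀ k`. -/
theorem spliceSched_add {m : ℕ} {n₀ : ℕ → ℕ} {sched : ℕ → ℕ × ℕ}
    (hs : ∀ n, sched (n + 1) =
      if (sched n).1 + 1 < m ∧ n₀ (sched n).1 ≤ (sched n).2 then ((sched n).1 + 1, 0)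
      else ((sched n).1, (sched n).2 + 1))
    {k p : ℕ} (hp : sched p = (k, 0)) : ∀ i, i ≤ n₀ k → sched (p + i) = (k, i) := by
  intro i
  induction i with
  | zero => exact fun _ => hp
  | succ i ih =>
    intro hi
    have h := ih (Nat.le_of_succ_le hi)
    have hc : ¬ ((sched (p + i)).1 + 1 < m ∧ n₀ (sched (p + i)).1 ≤ (sched (p + i)).2) := by
      rw [h]
      dsimp only
      omega
    show sched (p + i + 1) = _
    rw [hs, if_neg hc, h]

/-- **Band `k < m` enters the schedule at its offset `off k`**, at its level `0`; the offsets are characterised by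
`off 0 = 0`, `off (k + 1) = off k + n₀ k + 1` (band `k` occupies the `n₀ k + 1` positions `off k, …, off k + n₀ k`,
the last band every position from its offset on). -/
theorem spliceSched_off {m : ℕ} {n₀ : ℕ → ℕ} {sched : ℕ → ℕ × ℕ} {off : ℕ → ℕ} (h0 : sched 0 = (0, 0))
    (hs : ∀ n, sched (n + 1) =
      if (sched n).1 + 1 < m ∧ n₀ (sched n).1 ≤ (sched n).2 then ((sched n).1 + 1, 0)
      else ((sched n).1, (sched n).2 + 1))
    (hoff0 : off 0 = 0) (hoffs : ∀ k, off (k + 1) = off k + n₀ k + 1) :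
    ∀ k, k < m → sched (off k) = (k, 0) := by
  intro k
  induction k with
  | zero => intro; rw [hoff0, h0]
  | succ k ih =>
    intro hk
    have h := spliceSched_add hs (ih (Nat.lt_of_succ_lt hk)) (n₀ k) le_rfl
    have hc : (sched (off k + n₀ k)).1 + 1 < m ∧ n₀ (sched (off k + n₀ k)).1 ≤ (sched (off k + n₀ k)).2 := by
      rw [h]
      exact ⟨hk, le_rfl⟩
    rw [hoffs, hs, if_pos hc, h]

/-- **The last band keeps its own indexing**: for `k + 1 = m`, position `off k + i` lists level `i` of band `k`, for
every `i`. -/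
theorem spliceSched_last {m : ℕ} {n₀ : ℕ → ℕ} {sched : ℕ → ℕ × ℕ} {off : ℕ → ℕ} (h0 : sched 0 = (0, 0))
    (hs : ∀ n, sched (n + 1) =
      if (sched n).1 + 1 < m ∧ n₀ (sched n).1 ≤ (sched n).2 then ((sched n).1 + 1, 0)
      else ((sched n).1, (sched n).2 + 1))
    (hoff0 : off 0 = 0) (hoffs : ∀ k, off (k + 1) = off k + n₀ k + 1) {k : ℕ} (hk : k + 1 = m) :
    ∀ i, sched (off k + i) = (k, i) := by
  intro i
  induction i with
  | zero => exact spliceSched_off h0 hs hoff0 hoffs k (by omega)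
  | succ i ih =>
    have hc : ¬ ((sched (off k + i)).1 + 1 < m ∧ n₀ (sched (off k + i)).1 ≤ (sched (off k + i)).2) := by
      rw [ih]
      dsimp only
      omega
    show sched (off k + i + 1) = _
    rw [hs, if_neg hc, ih]

/-! ### The registered stub -/

/-- Registered stub `stub_spliceBandFamilies` (crux item stmt-CriticalPhenomena-10472, skeleton r16, band iteration
piece I6): **splicing finitely many band families at separated scales into one tame nested family.**  Given
`m ≥ 1` band families `B k` (`k < m`) at the root `c` with inner/outer radii `ρin k ≤ ρout k ≤ ρin (k + 1)` and
`ρout k ≤ R`, there is ONE sequence `S` of levels which is a tame nested family of radius `R` and complexity `N`,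
exterior-anchored, with class-`j` windows, fat bodies, fat spines and `z₀`-escapes, every level of which is a
level of some band, and in which every level of every band occurs.  Construction: `S n := B k i` for
`(k, i) = sched n` the splice schedule (`n₀ k` the stabilisation index of band `k`); nestedness inside a band is
the band's, across a seam it is `B k i ⊆ closedBall ρout k ⊆ closedBall ρin (k+1) ⊆ B (k+1) 0`; the root lies in every level
by `root_mem_of_bandFamily`; all per-level clauses transfer from the band the level comes from. -/
theorem stub_spliceBandFamilies :
    ∀ (Ω : Set ℂ) (δ ρ Rfar R : ℝ) (z₀ w : ℂ) (N m : ℕ) (j : Fin 6) (c : HexVertex) (ρin ρout : ℕ → ℝ)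
      (B : ℕ → ℕ → Set HexVertex), 0 < m →
      (∀ k, k < m → BandFamily Ω δ (ρin k) (ρout k) ρ Rfar z₀ w N j c (B k)) →
      (∀ k, k + 1 < m → ρout k ≤ ρin (k + 1)) →
      (∀ k, k < m → ρout k ≤ R) →
      ∃ S : ℕ → Set HexVertex,
        TameNestedFamily δ R N c S ∧ (∀ n, ExteriorAnchored Ω δ (S n) c) ∧
        ClassWindows j Ω δ ρ S ∧ FatUnderWindowK j Ω δ ρ S c ∧ FatSpine δ ρ S c ∧
        (∀ (n : ℕ) (p q : HexVertex), HasCleanWindow Ω δ ρ (S n) p q → ZEscape Ω δ ρ Rfar z₀ w (S n) q) ∧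
        (∀ n, ∃ k, k < m ∧ ∃ n', S n = B k n') ∧
        (∀ k, k < m → ∀ n', ∃ n, S n = B k n') := by
  intro Ω δ ρ Rfar R z₀ w N m j c ρin ρout B hm hB hsep hR
  -- stabilisation indices of the bands (anything for `k ≥ m`)
  have hex : ∀ k, ∃ n₀ : ℕ, k < m → ∀ n, n₀ ≤ n → B k n = B k n₀ := by
    intro k
    by_cases hk : k < m
    · obtain ⟨n₀, h⟩ := (hB k hk).2.1
      exact ⟨n₀, fun _ => h⟩
    · exact ⟨0, fun h => absurd h hk⟩
  choose n₀ hn₀ using hex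
  -- the splice schedule and its offsets, by their recursions
  obtain ⟨sched, h0, hs⟩ : ∃ sched : ℕ → ℕ × ℕ, sched 0 = (0, 0) ∧ ∀ n, sched (n + 1) =
      if (sched n).1 + 1 < m ∧ n₀ (sched n).1 ≤ (sched n).2 then ((sched n).1 + 1, 0)
      else ((sched n).1, (sched n).2 + 1) :=
    ⟨fun n => Nat.rec (motive := fun _ => ℕ × ℕ) (0, 0)
      (fun _ s => if s.1 + 1 < m ∧ n₀ s.1 ≤ s.2 then (s.1 + 1, 0) else (s.1, s.2 + 1)) n, rfl, fun _ => rfl⟩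
  obtain ⟨off, hoff0, hoffs⟩ : ∃ off : ℕ → ℕ, off 0 = 0 ∧ ∀ k, off (k + 1) = off k + n₀ k + 1 :=
    ⟨fun k => Nat.rec (motive := fun _ => ℕ) 0 (fun k o => o + n₀ k + 1) k, rfl, fun _ => rfl⟩
  -- across a seam: every level of band `k` lies in every level of band `k + 1`
  have hseam : ∀ k, k + 1 < m → ∀ a b, B k a ⊆ B (k + 1) b := by
    intro k hk a b v hv
    have h1 := (hB k (Nat.lt_of_succ_lt hk)).2.2.2.1 a v hv
    exact (hB (k + 1) hk).2.2.1 b v (h1.trans (hsep k hk))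
  have hlt : ∀ n, (sched n).1 < m := spliceSched_fst_lt h0 hs hm
  refine ⟨fun n => B (sched n).1 (sched n).2, ⟨?_, ?_, ?_, ?_, ?_⟩, ?_, ?_, ?_, ?_, ?_, ?_, ?_⟩
  · -- nested
    intro n
    show B _ _ ⊆ B _ _
    rw [hs]
    split_ifs with h
    · exact hseam _ h.1 _ _
    · exact (hB _ (hlt n)).1 _
  · -- the root
    intro n
    exact root_mem_of_bandFamily (hB _ (hlt n)) _
  · -- locality at scale `R`
    intro n v hv
    exact ((hB _ (hlt n)).2.2.2.1 _ v hv).trans (hR _ (hlt n))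
  · -- lattice-connected
    intro n
    exact (hB _ (hlt n)).2.2.2.2.1 _
  · -- at most `N` hexagons
    intro n
    exact (hB _ (hlt n)).2.2.2.2.2.1 _
  · -- exterior-anchored
    intro n
    exact (hB _ (hlt n)).2.2.2.2.2.2.1 _
  · -- class-`j` windows
    intro n p q h
    exact (hB _ (hlt n)).2.2.2.2.2.2.2.1 _ p q h
  · -- fat bodies under clean windows
    intro n p q h
    exact (hB _ (hlt n)).2.2.2.2.2.2.2.2.1 _ p q h
  · -- fat spines
    intro n
    exact (hB _ (hlt n)).2.2.2.2.2.2.2.2.2.1 _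
  · -- escapes
    intro n p q h
    exact (hB _ (hlt n)).2.2.2.2.2.2.2.2.2.2 _ p q h
  · -- every level is a band level
    intro n
    exact ⟨_, hlt n, _, rfl⟩
  · -- every band level occurs
    intro k hk n'
    rcases Nat.lt_or_ge (k + 1) m with hk1 | hk1
    · -- not the last band: levels up to the stabilisation index occur literally, later ones equal the stable one
      rcases le_or_gt n' (n₀ k) with hn | hn
      · refine ⟨off k + n', ?_⟩
        show B _ _ = _
        rw [spliceSched_add hs (spliceSched_off h0 hs hoff0 hoffs k hk) n' hn]
      · refine ⟨off k + n₀ k, ?_⟩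
        show B _ _ = _
        rw [spliceSched_add hs (spliceSched_off h0 hs hoff0 hoffs k hk) (n₀ k) le_rfl, hn₀ k hk n' hn.le]
    · -- the last band
      have hkm : k + 1 = m := le_antisymm hk hk1
      refine ⟨off k + n', ?_⟩
      show B _ _ = _
      rw [spliceSched_last h0 hs hoff0 hoffs hkm n']

end Summit.CriticalPhenomena.SAWScalingLimit.Theorems.ObservableToSLE.TypeLadder

end
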